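import Literature.NumberTheory.Transcendental.ComplexFormsProofs
import Literature.NumberTheory.Transcendental.KaehlerHodgeOfRealProofs
import Literature.AlgebraicGeometry.Motives.HodgeDecomposition
import HarnessLib

/-!
# The real structure of complex de Rham cohomology: `H^k_dR(M; ℂ) = H^k_dR(M; ℝ) ⊗ ℂ`

Trunk **T-KAEHLER** (`NumberTheory/Transcendental`). Companion to `ComplexForms` (C9's complex
de Rham cohomology `complexDeRhamCohomology E M k = Z^k(M; ℂ)/B^k(M; ℂ)`), `KaehlerHodge` /
`KaehlerHodgeOfRealProofs` (real and imaginary parts of complex forms; `d` is a real operator: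
`Re dα = d Re α`, `Im dα = d Im α` on smooth forms, `d(β ⊗ 1) = dβ ⊗ 1`, all PROVED) and
`ComplexFormsProofs` (v3: the `ℂ`-spans `Z^k(M; ℂ)`, `B^k(M; ℂ)` are G21's real modules of
closed, resp. exact, smooth `ℂ`-valued forms). It PROVES, on the tree's own carriers, the sentence
"`H^k(X, ℂ) = H^k(X, ℝ) ⊗ ℂ`, where complex conjugation acts naturally" of Voisin I, Cor. 6.12
(cf. Introduction, eq. (0.2): the operators act componentwise on `α = Re α + i Im α`) for DE RHAM
cohomology: real and imaginary parts and complexification of classes,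

* `complexDeRhamCohomology.re`, `.im : H^k_dR(M; ℂ) →ₗ[ℝ] H^k_dR(M; ℝ)` and
  `complexDeRhamCohomology.ofReal : H^k_dR(M; ℝ) →ₗ[ℝ] H^k_dR(M; ℂ)` (`H^k_dR(M; ℝ)` is G21's
  `deRhamCohomology 𝓘(ℝ, E) M ℝ k`), computed on representatives (`re_mk`, `im_mk`, `ofReal_mk`);
* `re (a ⊗ 1) = a`, `im (a ⊗ 1) = 0`, `c = (re c) ⊗ 1 + i • (im c) ⊗ 1`
  (`ofReal_re_add_I_smul_ofReal_im`: the decomposition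
  `H^k_dR(M; ℂ) = H^k_dR(M; ℝ) ⊕ i H^k_dR(M; ℝ)`),
  `re`/`im` of complex multiples, `ext_re_im`, `ofReal_injective`;
* conjugation (`complexDeRhamCohomology.conj`, `Motives/HodgeDecomposition`) is the conjugation of
  `H^k_dR(M; ℝ) ⊗ ℂ`: `re (conj c) = re c`, `im (conj c) = -im c`, `conj (a ⊗ 1) = a ⊗ 1`;
* naturality: `re (f^* c) = f^* (re c)` etc. for `C^∞` maps (`re_map`, `im_map`, `ofReal_map`),
  and the pull-back calculus with real coefficients from the one with complex coefficients
  (`PullbackFacts.real_of_complex`: `f^* β = Re f^*(β ⊗ 1)`).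

Everything is a theorem; no named facts. Consumer: the complexification of a real de Rham
isomorphism family (`AlgebraicGeometry/HodgeTheory/ComplexifiedDeRhamFamily`), deriving
`exists_isReal_complexDeRhamIsoFamily` from the real de Rham theorem `exists_deRhamIsoFamily`.

Design: `re`, `im` are defined on a chosen representative and shown independent of it
(`re_mk`; pattern of `HodgeTheory.conjClass`), then bundled `ℝ`-linearly; `ofReal` likewise. The
`ℝ`-module structure of `complexDeRhamCohomology E M k` is Mathlib's `Module.complexToReal`
(restriction of its `ℂ`-structure), so that `r • c = (r : ℂ) • c` definitionally.

## References

* C. Voisin, *Hodge Theory and Complex Algebraic Geometry I* (2002), Introduction eq. (0.2),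
  §5.3.1 Thm. 5.23, §6.1.3 Cor. 6.12.
* R. O. Wells, *Differential Analysis on Complex Manifolds* (1980), Ch. II §1.
-/

noncomputable section

open scoped Manifold ContDiff
open Set

namespace Literature.NumberTheory.Transcendental

variable {E : Type*} [NormedAddCommGroup E] [NormedSpace ℂ E]
  {M : Type*} [TopologicalSpace M] [ChartedSpace E M] {k : ℕ}

/-! ### Real and imaginary parts of forms: algebra supplements -/

section Forms
open Literature.Geometry.Kaehler (MForm IsSmoothForm IsClosedForm mextDeriv closedSmoothForms
  exactSmoothForms smoothForms)

/-- `Re 0 = 0`. [folklore] -/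
@[simp]
theorem _root_.Literature.Geometry.Kaehler.MForm.re_zero : (0 : MForm 𝓘(ℝ, E) M ℂ k).re = 0 := by
  funext x; ext v; simp

/-- `Im 0 = 0`. [folklore] -/
@[simp]
theorem _root_.Literature.Geometry.Kaehler.MForm.im_zero : (0 : MForm 𝓘(ℝ, E) M ℂ k).im = 0 := by
  funext x; ext v; simp

/-- `Re (α - β) = Re α - Re β`. [folklore] -/
theorem _root_.Literature.Geometry.Kaehler.MForm.re_sub (α β : MForm 𝓘(ℝ, E) M ℂ k) :
    (α - β).re = α.re - β.re := by
  funext x; ext v; simp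

/-- `Im (α - β) = Im α - Im β`. [folklore] -/
theorem _root_.Literature.Geometry.Kaehler.MForm.im_sub (α β : MForm 𝓘(ℝ, E) M ℂ k) :
    (α - β).im = α.im - β.im := by
  funext x; ext v; simp

/-- `Re (-α) = -Re α`. [folklore] -/
theorem _root_.Literature.Geometry.Kaehler.MForm.re_neg (α : MForm 𝓘(ℝ, E) M ℂ k) :
    (-α).re = -α.re := by
  funext x; ext v; simp

/-- `Im (-α) = -Im α`. [folklore] -/
theorem _root_.Literature.Geometry.Kaehler.MForm.im_neg (α : MForm 𝓘(ℝ, E) M ℂ k) :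
    (-α).im = -α.im := by
  funext x; ext v; simp

/-- `(α - β) ⊗ 1 = α ⊗ 1 - β ⊗ 1`. [folklore] -/
theorem _root_.Literature.Geometry.Kaehler.MForm.ofReal_sub (α β : MForm 𝓘(ℝ, E) M ℝ k) :
    (α - β).ofReal = α.ofReal - β.ofReal := by
  funext x; ext v; simp

/-- Real scalars act on complex forms through `ℝ ⊂ ℂ`: `r • α = (r : ℂ) • α` (definitional for
Mathlib's real action on `ℂ`). [folklore] -/
theorem _root_.Literature.Geometry.Kaehler.MForm.real_smul_eq_coe_smul (r : ℝ)
    (α : MForm 𝓘(ℝ, E) M ℂ k) :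
    r • α = (r : ℂ) • α := by
  funext x; ext v; simp

/-- `Re (r • α) = r • Re α` for real `r`. [folklore] -/
theorem _root_.Literature.Geometry.Kaehler.MForm.re_real_smul (r : ℝ) (α : MForm 𝓘(ℝ, E) M ℂ k) :
    (r • α).re = r • α.re := by
  funext x; ext v; simp

/-- `Im (r • α) = r • Im α` for real `r`. [folklore] -/
theorem _root_.Literature.Geometry.Kaehler.MForm.im_real_smul (r : ℝ) (α : MForm 𝓘(ℝ, E) M ℂ k) :
    (r • α).im = r • α.im := by
  funext x; ext v; simp

/-- `Re ᾱ = Re α`. [folklore] -/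
@[simp]
theorem _root_.Literature.Geometry.Kaehler.MForm.re_conj (α : MForm 𝓘(ℝ, E) M ℂ k) :
    α.conj.re = α.re := by
  funext x; ext v; simp

/-- `Im ᾱ = -Im α`. [folklore] -/
@[simp]
theorem _root_.Literature.Geometry.Kaehler.MForm.im_conj (α : MForm 𝓘(ℝ, E) M ℂ k) :
    α.conj.im = -α.im := by
  funext x; ext v; simp

/-- `β ↦ β ⊗ 1` is injective (`Re (β ⊗ 1) = β`). [folklore] -/
theorem _root_.Literature.Geometry.Kaehler.MForm.ofReal_injective :
    Function.Injective (Literature.Geometry.Kaehler.MForm.ofReal (E := E) (M := M) (k := k)) :=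
  fun α β h ↦ by rw [← Literature.Geometry.Kaehler.MForm.re_ofReal α, h,
    Literature.Geometry.Kaehler.MForm.re_ofReal]

/-- **Pull-back commutes with complexification**: `f^*(β ⊗ 1) = (f^* β) ⊗ 1` (definitional).
[folklore] -/
theorem _root_.Literature.Geometry.Kaehler.MForm.pullback_ofReal {E' : Type*}
    [NormedAddCommGroup E'] [NormedSpace ℂ E'] {N : Type*} [TopologicalSpace N] [ChartedSpace E' N]
    (f : M → N) (β : MForm 𝓘(ℝ, E') N ℝ k) :
    β.ofReal.pullback 𝓘(ℝ, E) f = (β.pullback 𝓘(ℝ, E) f).ofReal := by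
  funext x; ext v; rfl

/-- **Pull-back commutes with real parts**: `Re (f^* β) = f^* (Re β)` (definitional). [folklore] -/
theorem _root_.Literature.Geometry.Kaehler.MForm.re_pullback {E' : Type*} [NormedAddCommGroup E']
    [NormedSpace ℂ E'] {N : Type*} [TopologicalSpace N] [ChartedSpace E' N] (f : M → N)
    (β : MForm 𝓘(ℝ, E') N ℂ k) :
    (β.pullback 𝓘(ℝ, E) f).re = β.re.pullback 𝓘(ℝ, E) f := by
  funext x; ext v; rfl

/-- **Pull-back commutes with imaginary parts**: `Im (f^* β) = f^* (Im β)` (definitional).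
[folklore] -/
theorem _root_.Literature.Geometry.Kaehler.MForm.im_pullback {E' : Type*} [NormedAddCommGroup E']
    [NormedSpace ℂ E'] {N : Type*} [TopologicalSpace N] [ChartedSpace E' N] (f : M → N)
    (β : MForm 𝓘(ℝ, E') N ℂ k) :
    (β.pullback 𝓘(ℝ, E) f).im = β.im.pullback 𝓘(ℝ, E) f := by
  funext x; ext v; rfl

/-! ### Real and imaginary parts of closed and exact complex forms -/

/-- The real part of a closed smooth complex form is a closed smooth real form
(`Re dα = d Re α`, `MForm.re_mextDeriv_holds`). [cite: WellsDACM1980, Ch. II §1] -/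
theorem re_mem_closedSmoothForms {α : MForm 𝓘(ℝ, E) M ℂ k} (hα : α ∈ cclosedSmoothForms E M k) :
    α.re ∈ closedSmoothForms 𝓘(ℝ, E) M ℝ k := by
  obtain ⟨hs, hc⟩ := (mem_cclosedSmoothForms_iff α).1 hα
  refine ⟨hs.re, ?_⟩
  have h0 : mextDeriv α = 0 := hc
  change mextDeriv α.re = 0
  rw [← Literature.Geometry.Kaehler.MForm.re_mextDeriv_holds hs, h0,
    Literature.Geometry.Kaehler.MForm.re_zero]

/-- The imaginary part of a closed smooth complex form is a closed smooth real form
(`Im dα = d Im α`, `MForm.im_mextDeriv_holds`). [cite: WellsDACM1980, Ch. II §1] -/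
theorem im_mem_closedSmoothForms {α : MForm 𝓘(ℝ, E) M ℂ k} (hα : α ∈ cclosedSmoothForms E M k) :
    α.im ∈ closedSmoothForms 𝓘(ℝ, E) M ℝ k := by
  obtain ⟨hs, hc⟩ := (mem_cclosedSmoothForms_iff α).1 hα
  refine ⟨hs.im, ?_⟩
  have h0 : mextDeriv α = 0 := hc
  change mextDeriv α.im = 0
  rw [← Literature.Geometry.Kaehler.MForm.im_mextDeriv_holds hs, h0,
    Literature.Geometry.Kaehler.MForm.im_zero]

/-- The complexification of a closed smooth real form is a closed smooth complex form
(`d(β ⊗ 1) = dβ ⊗ 1`, `MForm.mextDeriv_ofReal_holds`). [cite: WellsDACM1980, Ch. II §1] -/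
theorem ofReal_mem_cclosedSmoothForms {β : MForm 𝓘(ℝ, E) M ℝ k}
    (hβ : β ∈ closedSmoothForms 𝓘(ℝ, E) M ℝ k) : β.ofReal ∈ cclosedSmoothForms E M k := by
  refine Submodule.subset_span ⟨hβ.1.ofReal, ?_⟩
  have h0 : mextDeriv β = 0 := hβ.2
  change mextDeriv β.ofReal = 0
  rw [Literature.Geometry.Kaehler.MForm.mextDeriv_ofReal_holds β, h0,
    Literature.Geometry.Kaehler.MForm.ofReal_zero]

/-- The real part of an exact smooth complex form is an exact smooth real form: `Re dβ = d Re β`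
with `Re β` smooth. [cite: WellsDACM1980, Ch. II §1] -/
theorem re_mem_exactSmoothForms {α : MForm 𝓘(ℝ, E) M ℂ k} (hα : α ∈ cexactSmoothForms E M k) :
    α.re ∈ exactSmoothForms 𝓘(ℝ, E) M ℝ k := by
  cases k with
  | zero =>
    have h : α = 0 := by simpa [cexactSmoothForms] using hα
    rw [h, Literature.Geometry.Kaehler.MForm.re_zero]
    exact Submodule.zero_mem _
  | succ k =>
    obtain ⟨β, hβ, rfl⟩ := (mem_cexactSmoothForms_succ_iff α).1 hα
    rw [Literature.Geometry.Kaehler.MForm.re_mextDeriv_holds hβ]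
    exact Submodule.subset_span ⟨β.re, hβ.re, rfl⟩

/-- The imaginary part of an exact smooth complex form is an exact smooth real form.
[cite: WellsDACM1980, Ch. II §1] -/
theorem im_mem_exactSmoothForms {α : MForm 𝓘(ℝ, E) M ℂ k} (hα : α ∈ cexactSmoothForms E M k) :
    α.im ∈ exactSmoothForms 𝓘(ℝ, E) M ℝ k := by
  cases k with
  | zero =>
    have h : α = 0 := by simpa [cexactSmoothForms] using hα
    rw [h, Literature.Geometry.Kaehler.MForm.im_zero]
    exact Submodule.zero_mem _
  | succ k =>
    obtain ⟨β, hβ, rfl⟩ := (mem_cexactSmoothForms_succ_iff α).1 hα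
    rw [Literature.Geometry.Kaehler.MForm.im_mextDeriv_holds hβ]
    exact Submodule.subset_span ⟨β.im, hβ.im, rfl⟩

/-- The complexification of an exact smooth real form is an exact smooth complex form:
`(dγ) ⊗ 1 = d(γ ⊗ 1)`. [cite: WellsDACM1980, Ch. II §1] -/
theorem ofReal_mem_cexactSmoothForms {β : MForm 𝓘(ℝ, E) M ℝ k}
    (hβ : β ∈ exactSmoothForms 𝓘(ℝ, E) M ℝ k) : β.ofReal ∈ cexactSmoothForms E M k := by
  cases k with
  | zero =>
    have h : β = 0 := by simpa [Literature.Geometry.Kaehler.exactSmoothForms] using hβ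
    rw [h, Literature.Geometry.Kaehler.MForm.ofReal_zero]
    exact Submodule.zero_mem _
  | succ k =>
    change β ∈ Submodule.span ℝ _ at hβ
    induction hβ using Submodule.span_induction with
    | mem x hx =>
      obtain ⟨γ, hγ, rfl⟩ := hx
      have hγ' : IsSmoothForm γ := hγ
      rw [← Literature.Geometry.Kaehler.MForm.mextDeriv_ofReal_holds γ]
      exact Submodule.subset_span ⟨γ.ofReal, (mem_csmoothForms_iff _).2 hγ'.ofReal, rfl⟩
    | zero => rw [Literature.Geometry.Kaehler.MForm.ofReal_zero]; exact Submodule.zero_mem _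
    | add x y _ _ hx hy => rw [Literature.Geometry.Kaehler.MForm.ofReal_add]; exact add_mem hx hy
    | smul r x _ hx =>
      rw [Literature.Geometry.Kaehler.MForm.ofReal_smul]; exact Submodule.smul_mem _ _ hx

/-! ### The pull-back calculus with real coefficients from the complex one -/

/-- **The pull-back calculus with real coefficients follows from the one with complex
coefficients** along the same maps: `f^* β = Re f^*(β ⊗ 1)` is smooth for smooth `β`, and
`d(f^* β) ⊗ 1 = d(f^*(β ⊗ 1)) = f^*(d(β ⊗ 1)) = (f^* dβ) ⊗ 1` with `⊗ 1` injective. (So the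
naturality hypotheses `[PullbackFacts … ℂ]` of the complex de Rham theory imply the real ones.)
[cite: WellsDACM1980, Ch. II §1] -/
theorem PullbackFacts.real_of_complex {E' : Type*} [NormedAddCommGroup E'] [NormedSpace ℂ E']
    {N : Type*} [TopologicalSpace N] [ChartedSpace E' N] [IsManifold 𝓘(ℝ, E) ∞ M]
    [IsManifold 𝓘(ℝ, E') ∞ N] [PullbackFacts 𝓘(ℝ, E) M 𝓘(ℝ, E') N ℂ] :
    PullbackFacts 𝓘(ℝ, E) M 𝓘(ℝ, E') N ℝ where
  isSmoothForm_pullback hf β hβ := by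
    have h := isSmoothForm_pullback (I := 𝓘(ℝ, E)) (M := M) hf hβ.ofReal
    rw [Literature.Geometry.Kaehler.MForm.pullback_ofReal] at h
    simpa using h.re
  mextDeriv_pullback hf β hβ := by
    apply Literature.Geometry.Kaehler.MForm.ofReal_injective
    rw [← Literature.Geometry.Kaehler.MForm.mextDeriv_ofReal_holds,
      ← Literature.Geometry.Kaehler.MForm.pullback_ofReal, mextDeriv_pullback hf hβ.ofReal,
      Literature.Geometry.Kaehler.MForm.mextDeriv_ofReal_holds,
      Literature.Geometry.Kaehler.MForm.pullback_ofReal]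

end Forms

/-! ### Real and imaginary parts and complexification of de Rham classes -/

namespace complexDeRhamCohomology

open Literature.Geometry.Kaehler (MForm deRhamCohomology closedSmoothForms exactSmoothForms)

/-- The real part of the class of `α`, as a class: `[Re α]` (auxiliary; see `re`). [folklore] -/
def reRep (α : cclosedSmoothForms E M k) : deRhamCohomology 𝓘(ℝ, E) M ℝ k :=
  deRhamCohomology.mk ⟨(α : MForm 𝓘(ℝ, E) M ℂ k).re, re_mem_closedSmoothForms α.2⟩

/-- The imaginary part of the class of `α`, as a class: `[Im α]` (auxiliary; see `im`).
[folklore] -/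
def imRep (α : cclosedSmoothForms E M k) : deRhamCohomology 𝓘(ℝ, E) M ℝ k :=
  deRhamCohomology.mk ⟨(α : MForm 𝓘(ℝ, E) M ℂ k).im, im_mem_closedSmoothForms α.2⟩

/-- `[Re α]` depends only on `[α]`: `Re` of an exact form is exact.
[cite: WellsDACM1980, Ch. II §1] -/
theorem reRep_eq_of_mk_eq {α β : cclosedSmoothForms E M k} (h : mk E M k α = mk E M k β) :
    reRep α = reRep β := by
  refine (deRhamCohomology.mk_eq_mk_iff _ _).2 ?_
  change (α : MForm 𝓘(ℝ, E) M ℂ k).re - (β : MForm 𝓘(ℝ, E) M ℂ k).re ∈ _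
  rw [← Literature.Geometry.Kaehler.MForm.re_sub]
  exact re_mem_exactSmoothForms ((mk_eq_mk_iff α β).1 h)

/-- `[Im α]` depends only on `[α]`. [cite: WellsDACM1980, Ch. II §1] -/
theorem imRep_eq_of_mk_eq {α β : cclosedSmoothForms E M k} (h : mk E M k α = mk E M k β) :
    imRep α = imRep β := by
  refine (deRhamCohomology.mk_eq_mk_iff _ _).2 ?_
  change (α : MForm 𝓘(ℝ, E) M ℂ k).im - (β : MForm 𝓘(ℝ, E) M ℂ k).im ∈ _
  rw [← Literature.Geometry.Kaehler.MForm.im_sub]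
  exact im_mem_exactSmoothForms ((mk_eq_mk_iff α β).1 h)

/-- Real scalars act on `H^k_dR(M; ℂ)` through `ℝ ⊂ ℂ` (`Module.complexToReal`):
`r • c = (r : ℂ) • c` (definitional). [folklore] -/
theorem real_smul_eq_coe_smul (r : ℝ) (c : complexDeRhamCohomology E M k) : r • c = (r : ℂ) • c :=
  rfl

variable (E M k) in
/-- **The real part of a complex de Rham class**, `H^k_dR(M; ℂ) →ₗ[ℝ] H^k_dR(M; ℝ)`, `[α] ↦ [Re α]`
(well defined because `Re` of an exact smooth form is exact, `d` being a real operator;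
`ℝ`-linear). [cite: VoisinHodgeI2002, §6.1.3 Cor. 6.12] -/
def re : complexDeRhamCohomology E M k →ₗ[ℝ] deRhamCohomology 𝓘(ℝ, E) M ℝ k where
  toFun c := reRep (mk_surjective c).choose
  map_add' c c' := by
    obtain ⟨α, rfl⟩ := mk_surjective c
    obtain ⟨β, rfl⟩ := mk_surjective c'
    have h : reRep (mk_surjective (mk E M k α + mk E M k β)).choose = reRep (α + β) :=
      reRep_eq_of_mk_eq (by rw [(mk_surjective (mk E M k α + mk E M k β)).choose_spec, map_add])
    rw [h, reRep_eq_of_mk_eq (mk_surjective (mk E M k α)).choose_spec,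
      reRep_eq_of_mk_eq (mk_surjective (mk E M k β)).choose_spec, reRep, reRep, reRep, ← map_add]
    exact congrArg _ (Subtype.ext (Literature.Geometry.Kaehler.MForm.re_add _ _))
  map_smul' r c := by
    obtain ⟨α, rfl⟩ := mk_surjective c
    have h : reRep (mk_surjective (r • mk E M k α)).choose = reRep ((r : ℂ) • α) :=
      reRep_eq_of_mk_eq (by rw [(mk_surjective (r • mk E M k α)).choose_spec, map_smul]; rfl)
    rw [RingHom.id_apply, h, reRep_eq_of_mk_eq (mk_surjective (mk E M k α)).choose_spec, reRep,
      reRep, ← map_smul]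
    refine congrArg _ (Subtype.ext ?_)
    change (((r : ℂ) • (α : MForm 𝓘(ℝ, E) M ℂ k))).re = r • (α : MForm 𝓘(ℝ, E) M ℂ k).re
    rw [← Literature.Geometry.Kaehler.MForm.real_smul_eq_coe_smul,
      Literature.Geometry.Kaehler.MForm.re_real_smul]

variable (E M k) in
/-- **The imaginary part of a complex de Rham class**, `H^k_dR(M; ℂ) →ₗ[ℝ] H^k_dR(M; ℝ)`,
`[α] ↦ [Im α]`. [cite: VoisinHodgeI2002, §6.1.3 Cor. 6.12] -/
def im : complexDeRhamCohomology E M k →ₗ[ℝ] deRhamCohomology 𝓘(ℝ, E) M ℝ k where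
  toFun c := imRep (mk_surjective c).choose
  map_add' c c' := by
    obtain ⟨α, rfl⟩ := mk_surjective c
    obtain ⟨β, rfl⟩ := mk_surjective c'
    have h : imRep (mk_surjective (mk E M k α + mk E M k β)).choose = imRep (α + β) :=
      imRep_eq_of_mk_eq (by rw [(mk_surjective (mk E M k α + mk E M k β)).choose_spec, map_add])
    rw [h, imRep_eq_of_mk_eq (mk_surjective (mk E M k α)).choose_spec,
      imRep_eq_of_mk_eq (mk_surjective (mk E M k β)).choose_spec, imRep, imRep, imRep, ← map_add]
    exact congrArg _ (Subtype.ext (Literature.Geometry.Kaehler.MForm.im_add _ _))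
  map_smul' r c := by
    obtain ⟨α, rfl⟩ := mk_surjective c
    have h : imRep (mk_surjective (r • mk E M k α)).choose = imRep ((r : ℂ) • α) :=
      imRep_eq_of_mk_eq (by rw [(mk_surjective (r • mk E M k α)).choose_spec, map_smul]; rfl)
    rw [RingHom.id_apply, h, imRep_eq_of_mk_eq (mk_surjective (mk E M k α)).choose_spec, imRep,
      imRep, ← map_smul]
    refine congrArg _ (Subtype.ext ?_)
    change (((r : ℂ) • (α : MForm 𝓘(ℝ, E) M ℂ k))).im = r • (α : MForm 𝓘(ℝ, E) M ℂ k).im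
    rw [← Literature.Geometry.Kaehler.MForm.real_smul_eq_coe_smul,
      Literature.Geometry.Kaehler.MForm.im_real_smul]

/-- **`re [α] = [Re α]`.** [cite: VoisinHodgeI2002, §6.1.3 Cor. 6.12] -/
theorem re_mk (α : cclosedSmoothForms E M k) :
    re E M k (mk E M k α) =
      deRhamCohomology.mk ⟨(α : MForm 𝓘(ℝ, E) M ℂ k).re, re_mem_closedSmoothForms α.2⟩ :=
  reRep_eq_of_mk_eq (mk_surjective (mk E M k α)).choose_spec

/-- **`im [α] = [Im α]`.** [cite: VoisinHodgeI2002, §6.1.3 Cor. 6.12] -/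
theorem im_mk (α : cclosedSmoothForms E M k) :
    im E M k (mk E M k α) =
      deRhamCohomology.mk ⟨(α : MForm 𝓘(ℝ, E) M ℂ k).im, im_mem_closedSmoothForms α.2⟩ :=
  imRep_eq_of_mk_eq (mk_surjective (mk E M k α)).choose_spec

variable (E M k) in
/-- Complexification on closed forms, `Z^k(M; ℝ) →ₗ[ℝ] Z^k(M; ℂ)`, `β ↦ β ⊗ 1`
(`ofReal_mem_cclosedSmoothForms`). [cite: WellsDACM1980, Ch. II §1] -/
def ofRealClosed : closedSmoothForms 𝓘(ℝ, E) M ℝ k →ₗ[ℝ] cclosedSmoothForms E M k where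
  toFun β := ⟨(β : MForm 𝓘(ℝ, E) M ℝ k).ofReal, ofReal_mem_cclosedSmoothForms β.2⟩
  map_add' β γ := Subtype.ext (Literature.Geometry.Kaehler.MForm.ofReal_add _ _)
  map_smul' r β := Subtype.ext (by
    change (r • (β : MForm 𝓘(ℝ, E) M ℝ k)).ofReal = r • (β : MForm 𝓘(ℝ, E) M ℝ k).ofReal
    rw [Literature.Geometry.Kaehler.MForm.ofReal_smul,
      Literature.Geometry.Kaehler.MForm.real_smul_eq_coe_smul])

/-- `ofRealClosed β = β ⊗ 1` (definitional). [folklore] -/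
@[simp]
theorem coe_ofRealClosed (β : closedSmoothForms 𝓘(ℝ, E) M ℝ k) :
    (ofRealClosed E M k β : MForm 𝓘(ℝ, E) M ℂ k) = (β : MForm 𝓘(ℝ, E) M ℝ k).ofReal :=
  rfl

variable (E M k) in
/-- **Complexification of real de Rham classes**, `H^k_dR(M; ℝ) →ₗ[ℝ] H^k_dR(M; ℂ)`,
`[β] ↦ [β ⊗ 1]` (well defined: `(dγ) ⊗ 1 = d(γ ⊗ 1)`). [cite: VoisinHodgeI2002, §6.1.3 Cor. 6.12] -/
def ofReal : deRhamCohomology 𝓘(ℝ, E) M ℝ k →ₗ[ℝ] complexDeRhamCohomology E M k :=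
  Submodule.liftQ _ (((mk E M k).restrictScalars ℝ).comp (ofRealClosed E M k))
    (by
      rintro β hβ
      rw [LinearMap.mem_ker, LinearMap.comp_apply, LinearMap.restrictScalars_apply]
      change mk E M k ⟨(β : MForm 𝓘(ℝ, E) M ℝ k).ofReal, _⟩ = 0
      rw [← (mk E M k).map_zero, mk_eq_mk_iff]
      change (β : MForm 𝓘(ℝ, E) M ℝ k).ofReal - (0 : MForm 𝓘(ℝ, E) M ℂ k) ∈ _
      rw [sub_zero]
      exact ofReal_mem_cexactSmoothForms hβ)

/-- **`ofReal [β] = [β ⊗ 1]`.** [cite: VoisinHodgeI2002, §6.1.3 Cor. 6.12] -/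
theorem ofReal_mk (β : closedSmoothForms 𝓘(ℝ, E) M ℝ k) :
    ofReal E M k (deRhamCohomology.mk β) =
      mk E M k ⟨(β : MForm 𝓘(ℝ, E) M ℝ k).ofReal, ofReal_mem_cclosedSmoothForms β.2⟩ :=
  rfl

/-- **`re (a ⊗ 1) = a`.** [cite: VoisinHodgeI2002, §6.1.3 Cor. 6.12] -/
@[simp]
theorem re_ofReal (a : deRhamCohomology 𝓘(ℝ, E) M ℝ k) : re E M k (ofReal E M k a) = a := by
  obtain ⟨β, rfl⟩ := deRhamCohomology.mk_surjective a
  rw [ofReal_mk, re_mk]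
  exact congrArg _ (Subtype.ext (Literature.Geometry.Kaehler.MForm.re_ofReal _))

/-- **`im (a ⊗ 1) = 0`.** [cite: VoisinHodgeI2002, §6.1.3 Cor. 6.12] -/
@[simp]
theorem im_ofReal (a : deRhamCohomology 𝓘(ℝ, E) M ℝ k) : im E M k (ofReal E M k a) = 0 := by
  obtain ⟨β, rfl⟩ := deRhamCohomology.mk_surjective a
  rw [ofReal_mk, im_mk, ← (deRhamCohomology.mk (I := 𝓘(ℝ, E)) (M := M) (F := ℝ) (k := k)).map_zero]
  exact congrArg _ (Subtype.ext (Literature.Geometry.Kaehler.MForm.im_ofReal _))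

/-- **`c = (re c) ⊗ 1 + i • (im c) ⊗ 1`**: `H^k_dR(M; ℂ) = H^k_dR(M; ℝ) ⊗ ℂ`.
[cite: VoisinHodgeI2002, §6.1.3 Cor. 6.12] -/
theorem ofReal_re_add_I_smul_ofReal_im (c : complexDeRhamCohomology E M k) :
    ofReal E M k (re E M k c) + Complex.I • ofReal E M k (im E M k c) = c := by
  obtain ⟨α, rfl⟩ := mk_surjective c
  rw [re_mk, im_mk, ofReal_mk, ofReal_mk, ← map_smul, ← map_add]
  exact congrArg _
    (Subtype.ext (Literature.Geometry.Kaehler.MForm.ofReal_re_add_I_smul_ofReal_im _))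

/-- Two complex classes with the same real and imaginary parts are equal. [folklore] -/
theorem ext_re_im {c c' : complexDeRhamCohomology E M k} (hre : re E M k c = re E M k c')
    (him : im E M k c = im E M k c') : c = c' := by
  rw [← ofReal_re_add_I_smul_ofReal_im c, ← ofReal_re_add_I_smul_ofReal_im c', hre, him]

/-- `a ↦ a ⊗ 1` is injective on de Rham classes. [folklore] -/
theorem ofReal_injective : Function.Injective (ofReal E M k) :=
  fun a a' h ↦ by rw [← re_ofReal a, h, re_ofReal]

/-- **Real part of a complex multiple**: `re (z • c) = Re z • re c - Im z • im c`.
[cite: VoisinHodgeI2002, §6.1.3 Cor. 6.12] -/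
theorem re_smul (z : ℂ) (c : complexDeRhamCohomology E M k) :
    re E M k (z • c) = z.re • re E M k c - z.im • im E M k c := by
  obtain ⟨α, rfl⟩ := mk_surjective c
  rw [← map_smul, re_mk, re_mk, im_mk, ← map_smul, ← map_smul, ← map_sub]
  exact congrArg _ (Subtype.ext (Literature.Geometry.Kaehler.MForm.re_smul z _))

/-- **Imaginary part of a complex multiple**: `im (z • c) = Re z • im c + Im z • re c`.
[cite: VoisinHodgeI2002, §6.1.3 Cor. 6.12] -/
theorem im_smul (z : ℂ) (c : complexDeRhamCohomology E M k) :
    im E M k (z • c) = z.re • im E M k c + z.im • re E M k c := by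
  obtain ⟨α, rfl⟩ := mk_surjective c
  rw [← map_smul, im_mk, re_mk, im_mk, ← map_smul, ← map_smul, ← map_add]
  exact congrArg _ (Subtype.ext (Literature.Geometry.Kaehler.MForm.im_smul z _))

/-- `re (i • c) = -im c`. [folklore] -/
theorem re_I_smul (c : complexDeRhamCohomology E M k) :
    re E M k (Complex.I • c) = -im E M k c := by
  rw [re_smul, Complex.I_re, Complex.I_im, zero_smul, one_smul, zero_sub]

/-- `im (i • c) = re c`. [folklore] -/
theorem im_I_smul (c : complexDeRhamCohomology E M k) :
    im E M k (Complex.I • c) = re E M k c := by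
  rw [im_smul, Complex.I_re, Complex.I_im, zero_smul, one_smul, zero_add]

/-- `re ((r : ℂ) • c) = r • re c`. [folklore] -/
theorem re_coe_smul (r : ℝ) (c : complexDeRhamCohomology E M k) :
    re E M k ((r : ℂ) • c) = r • re E M k c := by
  rw [re_smul, Complex.ofReal_re, Complex.ofReal_im, zero_smul, sub_zero]

/-- `im ((r : ℂ) • c) = r • im c`. [folklore] -/
theorem im_coe_smul (r : ℝ) (c : complexDeRhamCohomology E M k) :
    im E M k ((r : ℂ) • c) = r • im E M k c := by
  rw [im_smul, Complex.ofReal_re, Complex.ofReal_im, zero_smul, add_zero]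

/-- `(r • a) ⊗ 1 = (r : ℂ) • (a ⊗ 1)`. [folklore] -/
theorem ofReal_smul_eq_coe_smul (r : ℝ) (a : deRhamCohomology 𝓘(ℝ, E) M ℝ k) :
    ofReal E M k (r • a) = (r : ℂ) • ofReal E M k a := by
  rw [map_smul, real_smul_eq_coe_smul]

/-! ### Conjugation is the conjugation of `H^k_dR(M; ℝ) ⊗ ℂ` -/

section Conj

variable (hc : conj_mem_cclosedSmoothForms (E := E) (M := M) (k := k))
  (he : conj_mem_cexactSmoothForms (E := E) (M := M) (k := k))

/-- **`re (conj c) = re c`.** [cite: VoisinHodgeI2002, §6.1.3 Cor. 6.12] -/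
@[simp]
theorem re_conj (c : complexDeRhamCohomology E M k) :
    re E M k (conj E M k hc he c) = re E M k c := by
  obtain ⟨α, rfl⟩ := mk_surjective c
  rw [conj_mk, re_mk, re_mk]
  exact congrArg _ (Subtype.ext (Literature.Geometry.Kaehler.MForm.re_conj _))

/-- **`im (conj c) = -im c`.** [cite: VoisinHodgeI2002, §6.1.3 Cor. 6.12] -/
@[simp]
theorem im_conj (c : complexDeRhamCohomology E M k) :
    im E M k (conj E M k hc he c) = -im E M k c := by
  obtain ⟨α, rfl⟩ := mk_surjective c
  rw [conj_mk, im_mk, im_mk, ← map_neg]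
  exact congrArg _ (Subtype.ext (Literature.Geometry.Kaehler.MForm.im_conj _))

/-- **Real classes are real**: `conj (a ⊗ 1) = a ⊗ 1`. [cite: VoisinHodgeI2002, §6.1.3 Cor. 6.12] -/
@[simp]
theorem conj_ofReal (a : deRhamCohomology 𝓘(ℝ, E) M ℝ k) :
    conj E M k hc he (ofReal E M k a) = ofReal E M k a := by
  obtain ⟨β, rfl⟩ := deRhamCohomology.mk_surjective a
  rw [ofReal_mk, conj_mk]
  exact congrArg _ (Subtype.ext (Literature.Geometry.Kaehler.MForm.conj_ofReal _))

/-- **`conj c = (re c) ⊗ 1 - i • (im c) ⊗ 1`**: conjugation of complex de Rham classes is the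
conjugation of `H^k_dR(M; ℝ) ⊗ ℂ` on the second factor.
[cite: VoisinHodgeI2002, §6.1.3 Cor. 6.12] -/
theorem conj_eq_ofReal_re_sub (c : complexDeRhamCohomology E M k) :
    conj E M k hc he c = ofReal E M k (re E M k c) - Complex.I • ofReal E M k (im E M k c) := by
  refine ext_re_im ?_ ?_
  · rw [re_conj, map_sub, re_ofReal, re_I_smul, im_ofReal, neg_zero, sub_zero]
  · rw [im_conj, map_sub, im_ofReal, im_I_smul, re_ofReal, zero_sub]

end Conj

/-! ### Naturality -/

section Map

variable {E' : Type*} [NormedAddCommGroup E'] [NormedSpace ℂ E']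
  {N : Type*} [TopologicalSpace N] [ChartedSpace E' N]
  [IsManifold 𝓘(ℝ, E) ∞ M] [IsManifold 𝓘(ℝ, E') ∞ N]
  [PullbackFacts 𝓘(ℝ, E) M 𝓘(ℝ, E') N ℂ] [PullbackFacts 𝓘(ℝ, E) M 𝓘(ℝ, E') N ℝ]
  {f : M → N} (hf : ContMDiff 𝓘(ℝ, E) 𝓘(ℝ, E') ∞ f)

/-- **`re (f^* c) = f^* (re c)`** for a `C^∞` map `f` (both are `[Re f^* α] = [f^* Re α]`).
The real pull-back calculus `[PullbackFacts … ℝ]` is available from the complex one by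
`PullbackFacts.real_of_complex`. [cite: WellsDACM1980, Ch. II §1] -/
theorem re_map (c : complexDeRhamCohomology E' N k) :
    re E M k (map E hf k c) = deRhamCohomology.map hf k (re E' N k c) := by
  obtain ⟨α, rfl⟩ := mk_surjective c
  rw [map_mk, re_mk, re_mk, deRhamCohomology.map_mk]
  exact congrArg _ (Subtype.ext (Literature.Geometry.Kaehler.MForm.re_pullback f _))

/-- **`im (f^* c) = f^* (im c)`** for a `C^∞` map `f`. [cite: WellsDACM1980, Ch. II §1] -/
theorem im_map (c : complexDeRhamCohomology E' N k) :
    im E M k (map E hf k c) = deRhamCohomology.map hf k (im E' N k c) := by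
  obtain ⟨α, rfl⟩ := mk_surjective c
  rw [map_mk, im_mk, im_mk, deRhamCohomology.map_mk]
  exact congrArg _ (Subtype.ext (Literature.Geometry.Kaehler.MForm.im_pullback f _))

/-- **`(f^* a) ⊗ 1 = f^* (a ⊗ 1)`** for a `C^∞` map `f`. [cite: WellsDACM1980, Ch. II §1] -/
theorem ofReal_map (a : deRhamCohomology 𝓘(ℝ, E') N ℝ k) :
    ofReal E M k (deRhamCohomology.map hf k a) = map E hf k (ofReal E' N k a) := by
  obtain ⟨β, rfl⟩ := deRhamCohomology.mk_surjective a
  rw [deRhamCohomology.map_mk, ofReal_mk, ofReal_mk, map_mk]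
  exact congrArg _ (Subtype.ext (Literature.Geometry.Kaehler.MForm.pullback_ofReal f _).symm)

end Map

end complexDeRhamCohomology

end Literature.NumberTheory.Transcendental
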